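import Mathlib
import HarnessLib

/-!
# BalabanIR engine `BirComplexStableXY` (stmt-HubbardSuperconductivity-2080): the multidimensional
Laplace method with a complex phase (abstract part)

Support lemmas for crux 2 of route BalabanIR (`--supports stmt-HubbardSuperconductivity-2080`).
The typed engine claim asks for `Z ≠ 0 ∧ 1/2 ≤ Re (N / Z)` UNIFORMLY (`∃ K₀ ∀ K ≥ K₀ ∀ c ∀ L M`).
Its fixed-volume shadow (`∀ c ∀ L M ∃ K₁ ∀ K ≥ K₁`) is a genuine theorem, proved in the companion
files by the Laplace method on the torus `[0,2π]^Λ` after one spin is fixed by a unimodular shear.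
This file is the abstract analytic core, stated for an arbitrary finite index type `ι`
(configuration space `ι → ℝ`, product Lebesgue measure):

* a complex phase `f` on a measurable neighbourhood `S` of `0` with a COERCIVE real part,
  `m Σ_i δ_i² ≤ Re (f δ)` on `S`, and a degree-two homogeneous germ `q`,
  `‖f δ − q δ‖ ≤ C (Σ_i δ_i²) ‖δ‖` on `S`;
* a bounded continuous amplitude `g`.

Then (`birLaplace_tendsto`)
  `(√K)^{|ι|} ∫_S g e^{−K f} ⟶ g 0 · ∫_{ℝ^ι} e^{−q}`   as `K → ∞`,
by the substitution `δ = u / √K` (`Measure.integral_comp_smul`) and dominated convergence with the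
Gaussian majorant `e^{−m Σ u_i²}`; `Re q ≥ m Σ u_i²` (`birLaplace_re_quad_ge`) and the
integrability of `e^{−q}` (`birLaplace_integrable_cexp_neg_quad`) come for free from the two
hypotheses by homogeneity.  Corollaries: eventual non-vanishing (`birLaplace_eventually_ne_zero`)
and the limit of ratios of two such integrals (`birLaplace_tendsto_div`).  No definitions.

References: N. G. de Bruijn, *Asymptotic Methods in Analysis*, Ch. 4; the one-variable version in
this tree is `Literature.Analysis.Asymptotics.tendsto_sqrt_mul_integral_exp_phase`.
-/

namespace Summit.HubbardSuperconductivity.HubbardSuperconductivity.Theorems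

open scoped BigOperators
open MeasureTheory Filter Topology

section Laplace

variable {ι : Type*} [Fintype ι]

/-- `‖u‖² ≤ Σ_i u_i²` for the sup norm on `ι → ℝ`. -/
theorem birLaplace_norm_sq_le_sum_sq (u : ι → ℝ) : ‖u‖ ^ 2 ≤ ∑ i, u i ^ 2 := by
  have hs : 0 ≤ ∑ i, u i ^ 2 := Finset.sum_nonneg fun i _ => sq_nonneg (u i)
  have h1 : ‖u‖ ≤ Real.sqrt (∑ i, u i ^ 2) := by
    refine (pi_norm_le_iff_of_nonneg (Real.sqrt_nonneg _)).2 fun i => ?_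
    rw [Real.norm_eq_abs]
    refine Real.abs_le_sqrt ?_
    exact Finset.single_le_sum (f := fun j => u j ^ 2) (fun j _ => sq_nonneg (u j))
      (Finset.mem_univ i)
  calc ‖u‖ ^ 2 = ‖u‖ * ‖u‖ := sq ‖u‖
    _ ≤ Real.sqrt (∑ i, u i ^ 2) * Real.sqrt (∑ i, u i ^ 2) :=
        mul_self_le_mul_self (norm_nonneg _) h1
    _ = ∑ i, u i ^ 2 := Real.mul_self_sqrt hs

/-- `Σ_i (t u)_i² = t² Σ_i u_i²`. -/
theorem birLaplace_sum_sq_smul (t : ℝ) (u : ι → ℝ) :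
    ∑ i, (t • u) i ^ 2 = t ^ 2 * ∑ i, u i ^ 2 := by
  simp only [Pi.smul_apply, smul_eq_mul, mul_pow, Finset.mul_sum]

/-- The real part of the homogeneous germ inherits the coercive lower bound:
`m Σ u_i² ≤ Re (q u)` for EVERY `u`. -/
theorem birLaplace_re_quad_ge {S : Set (ι → ℝ)} (hS0 : S ∈ 𝓝 (0 : ι → ℝ))
    {f q : (ι → ℝ) → ℂ} (hqhom : ∀ (t : ℝ) (u : ι → ℝ), q (t • u) = (t : ℂ) ^ 2 * q u)
    {m C : ℝ} (hre : ∀ δ ∈ S, m * ∑ i, δ i ^ 2 ≤ (f δ).re)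
    (hrem : ∀ δ ∈ S, ‖f δ - q δ‖ ≤ C * (∑ i, δ i ^ 2) * ‖δ‖) (u : ι → ℝ) :
    m * ∑ i, u i ^ 2 ≤ (q u).re := by
  set s : ℝ := ∑ i, u i ^ 2 with hs
  -- `t • u → 0` as `t → 0⁺`, hence eventually in `S`
  have ht0 : Tendsto (fun t : ℝ => t • u) (𝓝[>] 0) (𝓝 0) := by
    have : Tendsto (fun t : ℝ => t • u) (𝓝 0) (𝓝 ((0 : ℝ) • u)) :=
      tendsto_id.smul_const u
    rw [zero_smul] at this
    exact this.mono_left nhdsWithin_le_nhds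
  have hmem : ∀ᶠ t in 𝓝[>] (0 : ℝ), t • u ∈ S := ht0.eventually_mem hS0
  have hpos : ∀ᶠ t in 𝓝[>] (0 : ℝ), 0 < t := eventually_mem_nhdsWithin
  -- the lower bound `m s - C s ‖u‖ t ≤ Re (q u)` for small `t > 0`
  have hineq : ∀ᶠ t in 𝓝[>] (0 : ℝ), m * s - C * s * ‖u‖ * t ≤ (q u).re := by
    filter_upwards [hmem, hpos] with t htS ht
    have h1 := hre _ htS
    have h2 := hrem _ htS
    rw [birLaplace_sum_sq_smul] at h1 h2
    rw [norm_smul, Real.norm_eq_abs, abs_of_pos ht] at h2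
    have hq : (q (t • u)).re = t ^ 2 * (q u).re := by
      rw [hqhom]
      have : ((t : ℂ)) ^ 2 = ((t ^ 2 : ℝ) : ℂ) := by push_cast; ring
      rw [this, Complex.re_ofReal_mul]
    have h3 : (f (t • u)).re - ‖f (t • u) - q (t • u)‖ ≤ (q (t • u)).re := by
      have := Complex.re_le_norm (f (t • u) - q (t • u))
      rw [Complex.sub_re] at this
      linarith
    have h4 : m * (t ^ 2 * s) - C * (t ^ 2 * s) * (t * ‖u‖) ≤ t ^ 2 * (q u).re := by
      rw [← hq]; linarith
    have ht2 : 0 < t ^ 2 := by positivity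
    have h5 : t ^ 2 * (m * s - C * s * ‖u‖ * t) ≤ t ^ 2 * (q u).re := by nlinarith
    exact le_of_mul_le_mul_left h5 ht2
  -- let `t → 0⁺`
  have hlim : Tendsto (fun t : ℝ => m * s - C * s * ‖u‖ * t) (𝓝[>] 0) (𝓝 (m * s)) := by
    have : Tendsto (fun t : ℝ => m * s - C * s * ‖u‖ * t) (𝓝 0) (𝓝 (m * s - C * s * ‖u‖ * 0)) :=
      (tendsto_const_nhds.sub (tendsto_const_nhds.mul tendsto_id))
    rw [mul_zero, sub_zero] at this
    exact this.mono_left nhdsWithin_le_nhds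
  exact le_of_tendsto hlim hineq

omit [Fintype ι] in
/-- `0 ∈ S` and the amplitude bound is non-negative. -/
theorem birLaplace_bound_nonneg {S : Set (ι → ℝ)} (hS0 : S ∈ 𝓝 (0 : ι → ℝ))
    {g : (ι → ℝ) → ℂ} {G₀ : ℝ} (hgb : ∀ δ ∈ S, ‖g δ‖ ≤ G₀) : 0 ≤ G₀ :=
  (norm_nonneg _).trans (hgb 0 (mem_of_mem_nhds hS0))

/-- The Gaussian majorant `u ↦ A e^{−m Σ u_i²}` is integrable on `ι → ℝ`. -/
theorem birLaplace_integrable_gaussian {m : ℝ} (hm : 0 < m) (A : ℝ) :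
    Integrable (fun u : ι → ℝ => A * Real.exp (-m * ∑ i, u i ^ 2)) := by
  have h : Integrable (fun u : ι → ℝ => ∏ i, Real.exp (-m * u i ^ 2))
      (Measure.pi fun _ : ι => (volume : Measure ℝ)) :=
    Integrable.fintype_prod (f := fun _ : ι => fun x : ℝ => Real.exp (-m * x ^ 2))
      fun _ => integrable_exp_neg_mul_sq hm
  have h' : Integrable (fun u : ι → ℝ => ∏ i, Real.exp (-m * u i ^ 2)) := by
    simpa only [volume_pi] using h
  refine (h'.const_mul A).congr (Eventually.of_forall fun u => ?_)
  simp only [Finset.mul_sum, Real.exp_sum]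

/-- `‖e^{−q u}‖ ≤ e^{−m Σ u_i²}`, hence `e^{−q}` is integrable. -/
theorem birLaplace_integrable_cexp_neg_quad {S : Set (ι → ℝ)} (hS0 : S ∈ 𝓝 (0 : ι → ℝ))
    {f q : (ι → ℝ) → ℂ} (hq : Continuous q)
    (hqhom : ∀ (t : ℝ) (u : ι → ℝ), q (t • u) = (t : ℂ) ^ 2 * q u)
    {m C : ℝ} (hm : 0 < m) (hre : ∀ δ ∈ S, m * ∑ i, δ i ^ 2 ≤ (f δ).re)
    (hrem : ∀ δ ∈ S, ‖f δ - q δ‖ ≤ C * (∑ i, δ i ^ 2) * ‖δ‖) :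
    Integrable (fun u : ι → ℝ => Complex.exp (-q u)) := by
  refine Integrable.mono' (birLaplace_integrable_gaussian hm 1)
    (by fun_prop : Continuous fun u : ι → ℝ => Complex.exp (-q u)).aestronglyMeasurable
    (Eventually.of_forall fun u => ?_)
  rw [Complex.norm_exp, Complex.neg_re, one_mul, Real.exp_le_exp]
  have := birLaplace_re_quad_ge hS0 hqhom hre hrem u
  linarith

/-- The substitution `δ = u / √K`: for `K > 0`,
`(√K)^{|ι|} ∫_S g e^{−K f} = ∫ 1_S(u/√K) g(u/√K) e^{−K f(u/√K)} du`. -/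
theorem birLaplace_scaling {S : Set (ι → ℝ)} (hS : MeasurableSet S)
    (f g : (ι → ℝ) → ℂ) {K : ℝ} (hK : 0 < K) :
    ((Real.sqrt K) ^ Fintype.card ι : ℝ) * ∫ δ in S, g δ * Complex.exp (-((K : ℂ) * f δ))
      = ∫ u : ι → ℝ, S.indicator (fun δ => g δ * Complex.exp (-((K : ℂ) * f δ)))
          ((Real.sqrt K)⁻¹ • u) := by
  set F : (ι → ℝ) → ℂ := S.indicator (fun δ => g δ * Complex.exp (-((K : ℂ) * f δ))) with hF
  have hsqrt : 0 < Real.sqrt K := Real.sqrt_pos.2 hK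
  have h := Measure.integral_comp_smul (μ := (volume : Measure (ι → ℝ))) F (Real.sqrt K)⁻¹
  rw [Module.finrank_fintype_fun_eq_card, inv_pow, inv_inv,
    abs_of_pos (pow_pos hsqrt _)] at h
  rw [h, hF, integral_indicator hS, Complex.real_smul]

/-- Pointwise limit of the rescaled integrand: for fixed `u`,
`1_S(u/√K) g(u/√K) e^{−K f(u/√K)} → g 0 · e^{−q u}` as `K → ∞`. -/
theorem birLaplace_pointwise {S : Set (ι → ℝ)} (hS0 : S ∈ 𝓝 (0 : ι → ℝ))
    {f q : (ι → ℝ) → ℂ} (hqhom : ∀ (t : ℝ) (u : ι → ℝ), q (t • u) = (t : ℂ) ^ 2 * q u)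
    {C : ℝ} (hrem : ∀ δ ∈ S, ‖f δ - q δ‖ ≤ C * (∑ i, δ i ^ 2) * ‖δ‖)
    {g : (ι → ℝ) → ℂ} (hg : Continuous g) (u : ι → ℝ) :
    Tendsto (fun K : ℝ => S.indicator (fun δ => g δ * Complex.exp (-((K : ℂ) * f δ)))
      ((Real.sqrt K)⁻¹ • u)) atTop (𝓝 (g 0 * Complex.exp (-q u))) := by
  set R : ℝ → ℝ := fun K => (Real.sqrt K)⁻¹ with hR
  have hR0 : Tendsto R atTop (𝓝 0) :=
    tendsto_inv_atTop_zero.comp Real.tendsto_sqrt_atTop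
  have hRu : Tendsto (fun K => R K • u) atTop (𝓝 0) := by
    simpa using hR0.smul_const u
  have hmem : ∀ᶠ K in atTop, R K • u ∈ S := hRu.eventually_mem hS0
  have hKpos : ∀ᶠ K : ℝ in atTop, 0 < K := eventually_gt_atTop 0
  -- `K R² = 1`
  have hKR : ∀ K : ℝ, 0 < K → K * R K ^ 2 = 1 := fun K hK => by
    simp only [hR, inv_pow, Real.sq_sqrt hK.le]; field_simp
  -- the amplitude
  have hgu : Tendsto (fun K => g (R K • u)) atTop (𝓝 (g 0)) :=
    (hg.tendsto 0).comp hRu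
  -- the phase: `K f (R u) → q u`
  have hphase : Tendsto (fun K : ℝ => (K : ℂ) * f (R K • u)) atTop (𝓝 (q u)) := by
    have hdecomp : ∀ᶠ K : ℝ in atTop,
        (K : ℂ) * f (R K • u) = q u + (K : ℂ) * (f (R K • u) - q (R K • u)) := by
      filter_upwards [hKpos] with K hK
      have : (K : ℂ) * q (R K • u) = q u := by
        rw [hqhom, ← mul_assoc]
        have h1 : (K : ℂ) * (R K : ℂ) ^ 2 = ((K * R K ^ 2 : ℝ) : ℂ) := by push_cast; ring
        rw [h1, hKR K hK]; simp
      linear_combination this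
    have herr : Tendsto (fun K : ℝ => (K : ℂ) * (f (R K • u) - q (R K • u))) atTop (𝓝 0) := by
      rw [tendsto_zero_iff_norm_tendsto_zero]
      have hb : Tendsto (fun K => C * (∑ i, u i ^ 2) * ‖u‖ * R K) atTop (𝓝 0) := by
        simpa using hR0.const_mul (C * (∑ i, u i ^ 2) * ‖u‖)
      refine squeeze_zero_norm' ?_ hb
      filter_upwards [hmem, hKpos] with K hKS hK
      rw [norm_norm, norm_mul, Complex.norm_real, Real.norm_eq_abs, abs_of_pos hK]
      have h2 := hrem _ hKS
      rw [birLaplace_sum_sq_smul, norm_smul, Real.norm_eq_abs,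
        abs_of_pos (by simp [hR, Real.sqrt_pos.2 hK] : 0 < R K)] at h2
      calc K * ‖f (R K • u) - q (R K • u)‖
          ≤ K * (C * (R K ^ 2 * ∑ i, u i ^ 2) * (R K * ‖u‖)) :=
            mul_le_mul_of_nonneg_left h2 hK.le
        _ = C * (∑ i, u i ^ 2) * ‖u‖ * R K * (K * R K ^ 2) := by ring
        _ = C * (∑ i, u i ^ 2) * ‖u‖ * R K := by rw [hKR K hK, mul_one]
    have := (tendsto_const_nhds (x := q u)).add herr
    rw [add_zero] at this
    exact this.congr' (hdecomp.mono fun K hK => hK.symm)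
  have hexp : Tendsto (fun K : ℝ => Complex.exp (-((K : ℂ) * f (R K • u)))) atTop
      (𝓝 (Complex.exp (-q u))) :=
    (Complex.continuous_exp.tendsto _).comp hphase.neg
  have hprod := hgu.mul hexp
  refine hprod.congr' ?_
  filter_upwards [hmem] with K hKS
  rw [Set.indicator_of_mem hKS]

/-- Domination of the rescaled integrand by the Gaussian majorant (for `K > 0`). -/
theorem birLaplace_domination {S : Set (ι → ℝ)}
    {f : (ι → ℝ) → ℂ} {m : ℝ} (hre : ∀ δ ∈ S, m * ∑ i, δ i ^ 2 ≤ (f δ).re)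
    {g : (ι → ℝ) → ℂ} {G₀ : ℝ} (hG₀ : 0 ≤ G₀) (hgb : ∀ δ ∈ S, ‖g δ‖ ≤ G₀)
    {K : ℝ} (hK : 0 < K) (u : ι → ℝ) :
    ‖S.indicator (fun δ => g δ * Complex.exp (-((K : ℂ) * f δ))) ((Real.sqrt K)⁻¹ • u)‖
      ≤ G₀ * Real.exp (-m * ∑ i, u i ^ 2) := by
  by_cases hmemS : (Real.sqrt K)⁻¹ • u ∈ S
  · rw [Set.indicator_of_mem hmemS, norm_mul, Complex.norm_exp]
    refine mul_le_mul (hgb _ hmemS) ?_ (Real.exp_pos _).le hG₀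
    rw [Real.exp_le_exp]
    have h1 := hre _ hmemS
    rw [birLaplace_sum_sq_smul, inv_pow, Real.sq_sqrt hK.le] at h1
    have h2 : (-((K : ℂ) * f ((Real.sqrt K)⁻¹ • u))).re = -(K * (f ((Real.sqrt K)⁻¹ • u)).re) := by
      rw [Complex.neg_re, Complex.re_ofReal_mul]
    rw [h2]
    have h3 : K * (m * (K⁻¹ * ∑ i, u i ^ 2)) = m * ∑ i, u i ^ 2 := by field_simp
    nlinarith
  · rw [Set.indicator_of_notMem hmemS, norm_zero]
    positivity

/-- **The multidimensional Laplace method with a complex phase** (normalised, fixed amplitude).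
With `S` a measurable neighbourhood of `0` in `ι → ℝ`, `f` continuous with `m Σδ_i² ≤ Re f δ` on
`S` (`m > 0`), `q` homogeneous of degree two with `‖f δ − q δ‖ ≤ C Σδ_i² ‖δ‖` on `S`,
and `g` continuous with `‖g‖ ≤ G₀` on `S`:
`(√K)^{|ι|} ∫_S g e^{−K f} → g 0 ∫ e^{−q}` as `K → ∞`. -/
theorem birLaplace_tendsto {S : Set (ι → ℝ)} (hS : MeasurableSet S) (hS0 : S ∈ 𝓝 (0 : ι → ℝ))
    {f q : (ι → ℝ) → ℂ} (hf : Continuous f)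
    (hqhom : ∀ (t : ℝ) (u : ι → ℝ), q (t • u) = (t : ℂ) ^ 2 * q u)
    {m C : ℝ} (hm : 0 < m) (hre : ∀ δ ∈ S, m * ∑ i, δ i ^ 2 ≤ (f δ).re)
    (hrem : ∀ δ ∈ S, ‖f δ - q δ‖ ≤ C * (∑ i, δ i ^ 2) * ‖δ‖)
    {g : (ι → ℝ) → ℂ} (hg : Continuous g) {G₀ : ℝ} (hgb : ∀ δ ∈ S, ‖g δ‖ ≤ G₀) :
    Tendsto (fun K : ℝ => (((Real.sqrt K) ^ Fintype.card ι : ℝ) : ℂ) *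
        ∫ δ in S, g δ * Complex.exp (-((K : ℂ) * f δ))) atTop
      (𝓝 (g 0 * ∫ u : ι → ℝ, Complex.exp (-q u))) := by
  have hG₀ := birLaplace_bound_nonneg hS0 hgb
  -- replace by the rescaled integral (eventually, `K > 0`)
  have heq : ∀ᶠ K : ℝ in atTop, (((Real.sqrt K) ^ Fintype.card ι : ℝ) : ℂ) *
        ∫ δ in S, g δ * Complex.exp (-((K : ℂ) * f δ))
      = ∫ u : ι → ℝ, S.indicator (fun δ => g δ * Complex.exp (-((K : ℂ) * f δ)))
          ((Real.sqrt K)⁻¹ • u) := by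
    filter_upwards [eventually_gt_atTop 0] with K hK
    exact birLaplace_scaling hS f g hK
  have hlimeq : g 0 * ∫ u : ι → ℝ, Complex.exp (-q u)
      = ∫ u : ι → ℝ, g 0 * Complex.exp (-q u) := (integral_const_mul _ _).symm
  rw [hlimeq]
  refine Tendsto.congr' (heq.mono fun K hK => hK.symm) ?_
  refine tendsto_integral_filter_of_dominated_convergence
    (fun u => G₀ * Real.exp (-m * ∑ i, u i ^ 2)) ?_ ?_ (birLaplace_integrable_gaussian hm G₀) ?_
  · filter_upwards with K
    have hmeas : MeasurableSet ((fun u : ι → ℝ => (Real.sqrt K)⁻¹ • u) ⁻¹' S) :=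
      (continuous_const_smul _).measurable hS
    have : (fun u : ι → ℝ => S.indicator (fun δ => g δ * Complex.exp (-((K : ℂ) * f δ)))
        ((Real.sqrt K)⁻¹ • u)) = ((fun u : ι → ℝ => (Real.sqrt K)⁻¹ • u) ⁻¹' S).indicator
          (fun u => g ((Real.sqrt K)⁻¹ • u) *
            Complex.exp (-((K : ℂ) * f ((Real.sqrt K)⁻¹ • u)))) := by
      ext u
      simp only [Set.indicator, Set.mem_preimage]
      rfl
    rw [this]
    exact (Continuous.aestronglyMeasurable (by fun_prop)).indicator hmeas
  · filter_upwards [eventually_gt_atTop 0] with K hK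
    exact Eventually.of_forall fun u => birLaplace_domination hre hG₀ hgb hK u
  · exact Eventually.of_forall fun u => birLaplace_pointwise hS0 hqhom hrem hg u

/-- Corollary: if `g 0 · ∫ e^{−q} ≠ 0` then `∫_S g e^{−K f} ≠ 0` for all large `K`. -/
theorem birLaplace_eventually_ne_zero {S : Set (ι → ℝ)} (hS : MeasurableSet S)
    (hS0 : S ∈ 𝓝 (0 : ι → ℝ))
    {f q : (ι → ℝ) → ℂ} (hf : Continuous f)
    (hqhom : ∀ (t : ℝ) (u : ι → ℝ), q (t • u) = (t : ℂ) ^ 2 * q u)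
    {m C : ℝ} (hm : 0 < m) (hre : ∀ δ ∈ S, m * ∑ i, δ i ^ 2 ≤ (f δ).re)
    (hrem : ∀ δ ∈ S, ‖f δ - q δ‖ ≤ C * (∑ i, δ i ^ 2) * ‖δ‖)
    {g : (ι → ℝ) → ℂ} (hg : Continuous g) {G₀ : ℝ} (hgb : ∀ δ ∈ S, ‖g δ‖ ≤ G₀)
    (hne : g 0 * ∫ u : ι → ℝ, Complex.exp (-q u) ≠ 0) :
    ∀ᶠ K : ℝ in atTop, (∫ δ in S, g δ * Complex.exp (-((K : ℂ) * f δ))) ≠ 0 := by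
  have h := (birLaplace_tendsto hS hS0 hf hqhom hm hre hrem hg hgb).eventually_ne hne
  exact h.mono fun K hK h0 => hK (by rw [h0, mul_zero])

/-- Corollary: the ratio of two such integrals tends to the ratio of the amplitudes at `0`
(`g₂ 0 ≠ 0`, `∫ e^{−q} ≠ 0`). -/
theorem birLaplace_tendsto_div {S : Set (ι → ℝ)} (hS : MeasurableSet S)
    (hS0 : S ∈ 𝓝 (0 : ι → ℝ))
    {f q : (ι → ℝ) → ℂ} (hf : Continuous f)
    (hqhom : ∀ (t : ℝ) (u : ι → ℝ), q (t • u) = (t : ℂ) ^ 2 * q u)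
    {m C : ℝ} (hm : 0 < m) (hre : ∀ δ ∈ S, m * ∑ i, δ i ^ 2 ≤ (f δ).re)
    (hrem : ∀ δ ∈ S, ‖f δ - q δ‖ ≤ C * (∑ i, δ i ^ 2) * ‖δ‖)
    {g₁ g₂ : (ι → ℝ) → ℂ} (hg₁ : Continuous g₁) (hg₂ : Continuous g₂) {G₁ G₂ : ℝ}
    (hgb₁ : ∀ δ ∈ S, ‖g₁ δ‖ ≤ G₁) (hgb₂ : ∀ δ ∈ S, ‖g₂ δ‖ ≤ G₂)
    (hg₂0 : g₂ 0 ≠ 0) (hG : (∫ u : ι → ℝ, Complex.exp (-q u)) ≠ 0) :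
    Tendsto (fun K : ℝ => (∫ δ in S, g₁ δ * Complex.exp (-((K : ℂ) * f δ))) /
        (∫ δ in S, g₂ δ * Complex.exp (-((K : ℂ) * f δ)))) atTop (𝓝 (g₁ 0 / g₂ 0)) := by
  have h₁ := birLaplace_tendsto hS hS0 hf hqhom hm hre hrem hg₁ hgb₁
  have h₂ := birLaplace_tendsto hS hS0 hf hqhom hm hre hrem hg₂ hgb₂
  have hlim : g₁ 0 / g₂ 0 = (g₁ 0 * ∫ u : ι → ℝ, Complex.exp (-q u)) /
      (g₂ 0 * ∫ u : ι → ℝ, Complex.exp (-q u)) := by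
    rw [mul_div_mul_right _ _ hG]
  rw [hlim]
  refine (h₁.div h₂ (mul_ne_zero hg₂0 hG)).congr' ?_
  filter_upwards [eventually_gt_atTop 0] with K hK
  have hne : (((Real.sqrt K) ^ Fintype.card ι : ℝ) : ℂ) ≠ 0 := by
    exact_mod_cast (pow_pos (Real.sqrt_pos.2 hK) _).ne'
  simp only [Pi.div_apply]
  rw [mul_div_mul_left _ _ hne]

end Laplace

end Summit.HubbardSuperconductivity.HubbardSuperconductivity.Theorems
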